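import Summits.Ventures.PercRepro.RLSRuleTriangleGeom

/-!
# C-025 at q = 3: the triangle plane — the supply in abstract witness sums (night-3, gen 4)

* `rho3_eq_of_triangle` — `ρ₃(B′) = C(b, 3) − #{lines inside B′}`;
* **`triangle_supply`** — all three lines charged (`Λ = L`; the per-subset bound is `kFour_piece_bound`, which is
  shape-free): `17T₀ + 9(3T₁ − 3L₁) + 6·4T₁ + 3(9T₂ − 9L₂) + 3(8T₂ − 16L₂) + (W − 3L_W) ≤ Σ_{S ∈ Yq} w⁺(G, S)`;
* **`triangle_supply_free`** — no loss (`Λ = ∅`): `17T₀ + 51T₁ + 51T₂ + W ≤ Σ_{S ∈ Yq} w⁺(G, S)`.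
Imports `RLSRuleTriangleGeom`.  Axioms: standard.
-/

open scoped Matroid

namespace PercRepro

namespace NightThree

open Finset ThmH PerFlat

variable {α : Type*} [DecidableEq α] {M : Matroid α} [M.Finite]

open scoped Classical in
omit [M.Finite] in
/-- `ρ₃(B′) + #{ℓ ∈ L : ℓ ⊆ B′} = C(|B′|, 3)` on a triangle plane. -/
theorem rho3_eq_of_triangle {G : Finset α} {L : Finset (Finset α)} (h : Triangle M G L) {B : Finset α}
    (hB : B ⊆ G) : rho3 M B + (L.filter (fun ℓ => ℓ ⊆ B)).card = B.card.choose 3 := by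
  have hdep := depTriples_eq_of_triangle h
  obtain ⟨hGc, hLc, hL, hdeg, hdeg2, hind⟩ := h
  have hfilt : (B.powersetCard 3).filter (fun (T : Finset α) => ¬ M.Indep (T : Set α)) = L.filter (fun ℓ => ℓ ⊆ B) := by
    ext T
    simp only [Finset.mem_filter, Finset.mem_powersetCard]
    constructor
    · rintro ⟨⟨hTB, hTc⟩, hdep'⟩
      have : T ∈ depTriples M G := by
        unfold depTriples; rw [Finset.mem_filter, Finset.mem_powersetCard]; exact ⟨⟨hTB.trans hB, hTc⟩, hdep'⟩
      rw [hdep] at this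
      exact ⟨this, hTB⟩
    · rintro ⟨hT, hTB⟩
      obtain ⟨_, hTc, hTr⟩ := hL T hT
      exact ⟨⟨hTB, hTc⟩, not_indep_of_eRk_two_card_three hTr hTc⟩
  unfold rho3
  rw [← hfilt, Finset.card_filter_add_card_filter_not, Finset.card_powersetCard]

open scoped Classical in
/-- **The profile accounting of the triangle plane, all three lines charged** (`Λ = L`). -/
theorem triangle_supply {p : ℕ} (hc : Core M p) {G K : Finset α} {L : Finset (Finset α)} {n N : ℕ}
    (hG : G ∈ flatsQ M 3) (h : Triangle M G L) (hKsub : K ⊆ gr M \ G) (hKind : M.Indep (K : Set α))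
    (hK : K.card = N + 3) (hn : 2 ≤ n) (C : Finset α → Finset α) (hC : ∀ ℓ ∈ L, C ℓ ⊆ K ∧ (C ℓ).card = 3)
    (hgood : ∀ ℓ ∈ L, ∀ X, ¬ C ℓ ⊆ X → GoodWitness M ℓ K X) :
    17 * (∑ X ∈ witnessFamily K n, 1 / (((3 + X.card).choose 3 : ℕ) : ℚ))
    + 9 * (3 * (∑ X ∈ witnessFamily K n, 1 / (((4 + X.card).choose 3 : ℕ) : ℚ))
        - 3 * ∑ j ∈ range (n - 2), (N.choose j : ℚ) * (1 / (((4 + (j + 3)).choose 3 : ℕ) : ℚ)))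
    + 6 * (4 * (∑ X ∈ witnessFamily K n, 1 / (((4 + X.card).choose 3 : ℕ) : ℚ)))
    + 3 * (9 * (∑ X ∈ witnessFamily K n, 1 / (((5 + X.card).choose 3 : ℕ) : ℚ))
        - 9 * ∑ j ∈ range (n - 2), (N.choose j : ℚ) * (1 / (((5 + (j + 3)).choose 3 : ℕ) : ℚ)))
    + 3 * (8 * (∑ X ∈ witnessFamily K n, 1 / (((5 + X.card).choose 3 : ℕ) : ℚ))
        - 16 * ∑ j ∈ range (n - 2), (N.choose j : ℚ) * (1 / (((5 + (j + 3)).choose 3 : ℕ) : ℚ)))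
    + (∑ _X ∈ witnessFamily K n, (1 : ℚ) - 3 * ∑ j ∈ range (n - 2), (N.choose j : ℚ) * (1 : ℚ))
    ≤ ∑ S ∈ Yq M (n + 4) 3, wPlus M G S := by
  obtain ⟨hmem3, h𝔅rank, hd34, hd5, hd6, hc3, hc4, hc5⟩ := triangle_family hc hG h
  have hdep := depTriples_eq_of_triangle h
  have h' := h
  obtain ⟨hGc, hLc, hL, hdeg, hdeg2, hind⟩ := h
  have hsup := supply_ge_profile hc hG hKsub hKind n L (fun ℓ hℓ hnot => by rw [hdep] at hℓ; exact absurd hℓ hnot) C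
    hgood h𝔅rank
  refine le_trans ?_ hsup
  set f : Finset α → Finset α → ℚ := fun B X =>
    if ∀ ℓ ∈ L, ℓ ⊆ B → ¬ C ℓ ⊆ X then profileShare M B X else 0 with hf
  -- the triples: no line inside, `ρ₃ = 1`
  have h3 : 17 * (∑ X ∈ witnessFamily K n, 1 / (((3 + X.card).choose 3 : ℕ) : ℚ)) ≤
      ∑ B ∈ (G.powersetCard 3).filter (fun T => T ∉ L), ∑ X ∈ witnessFamily K n, f B X := by
    have hval : ∀ B ∈ (G.powersetCard 3).filter (fun T => T ∉ L),
        ∑ X ∈ witnessFamily K n, 1 / (((3 + X.card).choose 3 : ℕ) : ℚ) ≤ ∑ X ∈ witnessFamily K n, f B X := by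
      intro B hB
      obtain ⟨hBG, hBc, hnl, _⟩ := hmem3 B hB
      have hb := kFour_piece_bound (M := M) L hK hn C hC (B := B) (by omega)
      have hj : (L.filter (fun ℓ => ℓ ⊆ B)).card = 0 := by
        rw [Finset.card_eq_zero, Finset.filter_eq_empty_iff]; exact hnl
      have hr : rho3 M B = 1 := by
        have := rho3_eq_of_triangle h' hBG
        rw [hj, hBc] at this
        simpa using this
      rw [hj, hr, hBc] at hb
      simpa using hb
    calc 17 * (∑ X ∈ witnessFamily K n, 1 / (((3 + X.card).choose 3 : ℕ) : ℚ))
        = ∑ B ∈ (G.powersetCard 3).filter (fun T => T ∉ L),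
            ∑ X ∈ witnessFamily K n, 1 / (((3 + X.card).choose 3 : ℕ) : ℚ) := by
          rw [Finset.sum_const, hc3, nsmul_eq_mul]; norm_num
      _ ≤ _ := Finset.sum_le_sum hval
  -- the `4`-subsets: `9` lined (`j = 1`, `ρ₃ = 3`), `6` generic
  have h4 : 9 * (3 * (∑ X ∈ witnessFamily K n, 1 / (((4 + X.card).choose 3 : ℕ) : ℚ))
        - 3 * ∑ j ∈ range (n - 2), (N.choose j : ℚ) * (1 / (((4 + (j + 3)).choose 3 : ℕ) : ℚ)))
      + 6 * (4 * (∑ X ∈ witnessFamily K n, 1 / (((4 + X.card).choose 3 : ℕ) : ℚ))) ≤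
      ∑ B ∈ G.powersetCard 4, ∑ X ∈ witnessFamily K n, f B X := by
    set vL : ℚ := 3 * (∑ X ∈ witnessFamily K n, 1 / (((4 + X.card).choose 3 : ℕ) : ℚ))
        - 3 * ∑ j ∈ range (n - 2), (N.choose j : ℚ) * (1 / (((4 + (j + 3)).choose 3 : ℕ) : ℚ)) with hvL
    set vg : ℚ := 4 * (∑ X ∈ witnessFamily K n, 1 / (((4 + X.card).choose 3 : ℕ) : ℚ)) with hvg
    have hval : ∀ B ∈ G.powersetCard 4,
        (if ∃ ℓ ∈ L, ℓ ⊆ B then vL else vg) ≤ ∑ X ∈ witnessFamily K n, f B X := by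
      intro B hB
      obtain ⟨hBG, hBc⟩ := Finset.mem_powersetCard.1 hB
      have hb := kFour_piece_bound (M := M) L hK hn C hC (B := B) (by omega)
      have hj1 := lines_subset_four_triangle hc hG h' hBG hBc
      have hr := rho3_eq_of_triangle h' hBG
      rw [hBc, show Nat.choose 4 3 = 4 by norm_num [Nat.choose]] at hr
      by_cases hex : ∃ ℓ ∈ L, ℓ ⊆ B
      · rw [if_pos hex]
        have hj : (L.filter (fun ℓ => ℓ ⊆ B)).card = 1 := by
          obtain ⟨ℓ, hℓ, hl⟩ := hex
          have : 0 < (L.filter (fun ℓ => ℓ ⊆ B)).card := Finset.card_pos.2 ⟨ℓ, Finset.mem_filter.2 ⟨hℓ, hl⟩⟩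
          omega
        rw [hj] at hr hb
        have hr3 : rho3 M B = 3 := by omega
        rw [hr3, hBc] at hb
        rw [hvL]
        push_cast at hb
        linarith
      · rw [if_neg hex]
        have hj : (L.filter (fun ℓ => ℓ ⊆ B)).card = 0 := by
          rw [Finset.card_eq_zero, Finset.filter_eq_empty_iff]
          intro ℓ hℓ hl; exact hex ⟨ℓ, hℓ, hl⟩
        rw [hj] at hr hb
        have hr4 : rho3 M B = 4 := by omega
        rw [hr4, hBc] at hb
        rw [hvg]
        push_cast at hb
        linarith
    calc 9 * vL + 6 * vg = ∑ B ∈ G.powersetCard 4, (if ∃ ℓ ∈ L, ℓ ⊆ B then vL else vg) := by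
          rw [← Finset.sum_filter_add_sum_filter_not (G.powersetCard 4) (fun B => ∃ ℓ ∈ L, ℓ ⊆ B),
            Finset.sum_congr rfl (fun B hB => if_pos (Finset.mem_filter.1 hB).2),
            Finset.sum_congr rfl (fun B hB => if_neg (Finset.mem_filter.1 hB).2),
            Finset.sum_const, Finset.sum_const, card_lined_four_triangle hc hG h']
          have hrest : ((G.powersetCard 4).filter (fun B => ¬ ∃ ℓ ∈ L, ℓ ⊆ B)).card = 6 := by
            have := Finset.card_filter_add_card_filter_not (s := G.powersetCard 4) (fun B => ∃ ℓ ∈ L, ℓ ⊆ B)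
            rw [card_lined_four_triangle hc hG h', hc4] at this
            omega
          rw [hrest]
          simp only [nsmul_eq_mul]
          push_cast
          ring
      _ ≤ _ := Finset.sum_le_sum hval
  -- the `5`-subsets `G ∖ {v}`: `j = 3 − deg v`, `ρ₃ = 7 + deg v`
  have h5 : 3 * (9 * (∑ X ∈ witnessFamily K n, 1 / (((5 + X.card).choose 3 : ℕ) : ℚ))
        - 9 * ∑ j ∈ range (n - 2), (N.choose j : ℚ) * (1 / (((5 + (j + 3)).choose 3 : ℕ) : ℚ)))
      + 3 * (8 * (∑ X ∈ witnessFamily K n, 1 / (((5 + X.card).choose 3 : ℕ) : ℚ))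
        - 16 * ∑ j ∈ range (n - 2), (N.choose j : ℚ) * (1 / (((5 + (j + 3)).choose 3 : ℕ) : ℚ))) ≤
      ∑ B ∈ G.powersetCard 5, ∑ X ∈ witnessFamily K n, f B X := by
    set v9 : ℚ := 9 * (∑ X ∈ witnessFamily K n, 1 / (((5 + X.card).choose 3 : ℕ) : ℚ))
        - 9 * ∑ j ∈ range (n - 2), (N.choose j : ℚ) * (1 / (((5 + (j + 3)).choose 3 : ℕ) : ℚ)) with hv9
    set v8 : ℚ := 8 * (∑ X ∈ witnessFamily K n, 1 / (((5 + X.card).choose 3 : ℕ) : ℚ))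
        - 16 * ∑ j ∈ range (n - 2), (N.choose j : ℚ) * (1 / (((5 + (j + 3)).choose 3 : ℕ) : ℚ)) with hv8
    rw [sum_powersetCard_five hGc (fun B => ∑ X ∈ witnessFamily K n, f B X)]
    have hval : ∀ v ∈ G, (if (L.filter (fun ℓ => v ∈ ℓ)).card = 2 then v9 else v8) ≤
        ∑ X ∈ witnessFamily K n, f (G.erase v) X := by
      intro v hv
      have hBc : (G.erase v).card = 5 := by rw [Finset.card_erase_of_mem hv, hGc]
      have hb := kFour_piece_bound (M := M) L hK hn C hC (B := G.erase v) (by omega)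
      have hj := card_lines_in_erase (fun ℓ hℓ => (hL ℓ hℓ).1) (G := G) (L := L) (v := v)
      have hr := rho3_eq_of_triangle h' (Finset.erase_subset v G)
      rw [hBc, show Nat.choose 5 3 = 10 by norm_num [Nat.choose]] at hr
      rw [hLc] at hj
      rcases hdeg v hv with h1 | h2
      · rw [if_neg (by omega)]
        have hj2 : (L.filter (fun ℓ => ℓ ⊆ G.erase v)).card = 2 := by omega
        have hr8 : rho3 M (G.erase v) = 8 := by omega
        rw [hj2, hr8, hBc] at hb
        rw [hv8]
        push_cast at hb
        linarith
      · rw [if_pos h2]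
        have hj1 : (L.filter (fun ℓ => ℓ ⊆ G.erase v)).card = 1 := by omega
        have hr9 : rho3 M (G.erase v) = 9 := by omega
        rw [hj1, hr9, hBc] at hb
        rw [hv9]
        push_cast at hb
        linarith
    calc 3 * v9 + 3 * v8 = ∑ v ∈ G, (if (L.filter (fun ℓ => v ∈ ℓ)).card = 2 then v9 else v8) := by
          rw [← Finset.sum_filter_add_sum_filter_not G (fun v => (L.filter (fun ℓ => v ∈ ℓ)).card = 2),
            Finset.sum_congr rfl (fun v hv => if_pos (Finset.mem_filter.1 hv).2),
            Finset.sum_congr rfl (fun v hv => if_neg (Finset.mem_filter.1 hv).2),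
            Finset.sum_const, Finset.sum_const, hdeg2]
          have hrest : (G.filter (fun v => ¬ (L.filter (fun ℓ => v ∈ ℓ)).card = 2)).card = 3 := by
            have := Finset.card_filter_add_card_filter_not (s := G) (fun v => (L.filter (fun ℓ => v ∈ ℓ)).card = 2)
            rw [hdeg2, hGc] at this
            omega
          rw [hrest]
          simp only [nsmul_eq_mul]
          push_cast
          ring
      _ ≤ _ := Finset.sum_le_sum hval
  -- the plane itself: all three lines charged, the winner share
  have h6 : ∑ _X ∈ witnessFamily K n, (1 : ℚ) - 3 * ∑ j ∈ range (n - 2), (N.choose j : ℚ) * (1 : ℚ) ≤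
      ∑ X ∈ witnessFamily K n, f G X := by
    have hb := sum_good_ge_sub hn hK L C hC (fun _ => (1 : ℚ)) (fun _ => by positivity)
    rw [hLc] at hb
    push_cast at hb
    have hval : ∀ X ∈ witnessFamily K n, f G X = (if ∀ ℓ ∈ L, ¬ C ℓ ⊆ X then (fun _ => (1 : ℚ)) X.card else 0) := by
      intro X _
      rw [hf]
      dsimp only
      have : (∀ ℓ ∈ L, ℓ ⊆ G → ¬ C ℓ ⊆ X) ↔ (∀ ℓ ∈ L, ¬ C ℓ ⊆ X) :=
        ⟨fun hh ℓ hℓ => hh ℓ hℓ (hL ℓ hℓ).1, fun hh ℓ hℓ _ => hh ℓ hℓ⟩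
      by_cases hgd : ∀ ℓ ∈ L, ¬ C ℓ ⊆ X
      · rw [if_pos (this.2 hgd), if_pos hgd]; unfold profileShare; rw [if_neg (by omega)]
      · rw [if_neg (fun hh => hgd (this.1 hh)), if_neg hgd]
    rw [Finset.sum_congr rfl hval]
    exact hb
  rw [Finset.sum_union hd6, Finset.sum_union hd5, Finset.sum_union hd34, Finset.sum_singleton]
  linarith

end NightThree

end PercRepro
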